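import Literature.NumberTheory.EllipticCurves.SharpFlatPAdicLFunctionCoeffField
import Mathlib.Analysis.Normed.Group.Ultra
import HarnessLib

/-!
# Route `SignedLowerHalves`, crux L `SmallImageLowerHalfBothSigns` (stmt-BirchSwinnertonDyer-23599), line `rtt_w3` v13 — E2-num (BRIEF-E2 rev 2 §2/§4), LEAD:
# THE LEADING INDEX `d` OF THE E2-TAIL IS ADDITIVE UNDER PRODUCTS AND INVARIANT UNDER NON-ZERO CONSTANTS

WHY: the registered research stub `stub_charRoad_ns` (v13) concludes `∃ d, (∀ k, ‖coeff k L'‖ ≤ ‖coeff d L'‖) ∧ (∀ k < d, ‖coeff k L'‖ < ‖coeff d L'‖) ∧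
[F:ℚ_p]·(d + Σ_{S₀} …) ≤ λ(Dψ.X)` for `L' ∈ ℚ̄_p⟦T⟧` the image of Pollack's signed `p`-adic `L`-function of the partner: `d` is the LEADING INDEX of `L'` (first index at
which the Gauss norm is attained). In the cut of record the analytic identification E2-an_Σ reads `ι(Col^ε loc z_Σ) = c · L' · ∏_{w ∈ S₀K} P_w` in `ℚ̄_p⟦T⟧`, so the
glue needs: the leading index of a product is the sum of the leading indices (Gauss's lemma for the sup norm over an ultrametric field), and a non-zero constant does not
change it. This file proves exactly that, for power series over any normed field with ultrametric distance (instantiated at `PadicAlgCl p` by the consumer), with `d`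
spelled inline as in the stub (no definition). THEOREMS ONLY; nothing about `BirchSwinnertonDyer`, crux L or E2 is proved here.
[cite: Washington1997, §7.1 (Weierstrass preparation, degree is additive)] [cite: PollackWeston2011MT, §3.1 (λ of a finite-layer element)]
-/

set_option linter.dupNamespace false -- D-0017: single-problem summit, the namespace repeats the problem name by design

noncomputable section

open scoped Classical

namespace Summit.BirchSwinnertonDyer.BirchSwinnertonDyer.Theorems.SmallImageCharSignedSelmer

open PowerSeries

section LeadingIndex

variable {K : Type*} [NontriviallyNormedField K] [IsUltrametricDist K]

/-- **Gauss's lemma for the leading index.** If `f` has leading index `df` (all coefficient norms `≤ ‖a_{df}‖`, strictly smaller before `df`, `a_{df} ≠ 0`) and `g`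
has leading index `dg`, then `f·g` has leading index `df + dg` and leading norm `‖a_{df}‖·‖b_{dg}‖`. [cite: Washington1997, §7.1] -/
theorem leadingIndex_mul (f g : PowerSeries K) (df dg : ℕ)
    (hf : ∀ k, ‖coeff k f‖ ≤ ‖coeff df f‖) (hf' : ∀ k < df, ‖coeff k f‖ < ‖coeff df f‖) (hf0 : coeff df f ≠ 0)
    (hg : ∀ k, ‖coeff k g‖ ≤ ‖coeff dg g‖) (hg' : ∀ k < dg, ‖coeff k g‖ < ‖coeff dg g‖) (hg0 : coeff dg g ≠ 0) :
    ‖coeff (df + dg) (f * g)‖ = ‖coeff df f‖ * ‖coeff dg g‖ ∧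
      (∀ k, ‖coeff k (f * g)‖ ≤ ‖coeff (df + dg) (f * g)‖) ∧
      (∀ k < df + dg, ‖coeff k (f * g)‖ < ‖coeff (df + dg) (f * g)‖) := by
  have hA : 0 < ‖coeff df f‖ := norm_pos_iff.2 hf0
  have hB : 0 < ‖coeff dg g‖ := norm_pos_iff.2 hg0
  -- ultrametric strict bound for finite sums (cf. `Literature.RingTheory.PowerSeries.norm_sum_lt_of_forall_norm_lt`)
  have hsumlt : ∀ (s : Finset (ℕ × ℕ)) (a : ℕ × ℕ → K) {C : ℝ}, 0 < C → (∀ i ∈ s, ‖a i‖ < C) → ‖∑ i ∈ s, a i‖ < C :=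
    fun s a C hC h ↦ by
      rcases s.eq_empty_or_nonempty with rfl | hs
      · simpa using hC
      · exact (hs.norm_sum_le_sup'_norm a).trans_lt ((Finset.sup'_lt_iff hs).mpr h)
  have hterm : ∀ i j, ‖coeff i f * coeff j g‖ ≤ ‖coeff df f‖ * ‖coeff dg g‖ := fun i j ↦ by
    rw [norm_mul]
    exact mul_le_mul (hf i) (hg j) (norm_nonneg _) hA.le
  have hlt : ∀ i j, i < df ∨ j < dg → ‖coeff i f * coeff j g‖ < ‖coeff df f‖ * ‖coeff dg g‖ := by
    rintro i j (h | h)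
    · rw [norm_mul]
      exact (mul_le_mul_of_nonneg_left (hg j) (norm_nonneg _)).trans_lt (mul_lt_mul_of_pos_right (hf' i h) hB)
    · rw [norm_mul]
      exact (mul_le_mul_of_nonneg_right (hf i) (norm_nonneg _)).trans_lt (mul_lt_mul_of_pos_left (hg' j h) hA)
  -- the top coefficient: one dominant term
  have htop : ‖coeff (df + dg) (f * g)‖ = ‖coeff df f‖ * ‖coeff dg g‖ := by
    rw [coeff_mul, ← Finset.add_sum_erase _ _ (Finset.HasAntidiagonal.mem_antidiagonal.2 rfl :
      (df, dg) ∈ Finset.HasAntidiagonal.antidiagonal (df + dg))]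
    have hrest : ‖∑ x ∈ (Finset.HasAntidiagonal.antidiagonal (df + dg)).erase (df, dg), coeff x.1 f * coeff x.2 g‖ <
        ‖coeff df f‖ * ‖coeff dg g‖ := by
      refine hsumlt _ _ (mul_pos hA hB) fun x hx ↦ hlt _ _ ?_
      have hx' := Finset.HasAntidiagonal.mem_antidiagonal.1 (Finset.mem_of_mem_erase hx)
      have hne : x ≠ (df, dg) := Finset.ne_of_mem_erase hx
      by_contra hcon
      push Not at hcon
      have h1 : x.1 = df := by omega
      have h2 : x.2 = dg := by omega
      exact hne (Prod.ext h1 h2)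
    have hmain : ‖coeff df f * coeff dg g‖ = ‖coeff df f‖ * ‖coeff dg g‖ := norm_mul _ _
    rw [IsUltrametricDist.norm_add_eq_max_of_norm_ne_norm (by rw [hmain]; exact hrest.ne'), hmain, max_eq_left hrest.le]
  refine ⟨htop, fun k ↦ ?_, fun k hk ↦ ?_⟩
  · rw [htop, coeff_mul]
    exact IsUltrametricDist.norm_sum_le_of_forall_le_of_nonneg (mul_pos hA hB).le fun x _ ↦ hterm _ _
  · rw [htop, coeff_mul]
    refine hsumlt _ _ (mul_pos hA hB) fun x hx ↦ hlt _ _ ?_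
    have hx' := Finset.HasAntidiagonal.mem_antidiagonal.1 hx
    omega

omit [IsUltrametricDist K] in
/-- A non-zero constant does not change the leading index. [folklore] -/
theorem leadingIndex_C_mul (c : K) (hc : c ≠ 0) (f : PowerSeries K) (d : ℕ)
    (hf : ∀ k, ‖coeff k f‖ ≤ ‖coeff d f‖) (hf' : ∀ k < d, ‖coeff k f‖ < ‖coeff d f‖) :
    (∀ k, ‖coeff k (C c * f)‖ ≤ ‖coeff d (C c * f)‖) ∧ ∀ k < d, ‖coeff k (C c * f)‖ < ‖coeff d (C c * f)‖ := by
  have hc' : 0 < ‖c‖ := norm_pos_iff.2 hc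
  simp only [coeff_C_mul, norm_mul]
  exact ⟨fun k ↦ mul_le_mul_of_nonneg_left (hf k) hc'.le, fun k hk ↦ mul_lt_mul_of_pos_left (hf' k hk) hc'⟩

omit [IsUltrametricDist K] in
/-- The leading index is UNIQUE: two indices satisfying the leading-index clauses for the same series coincide. [folklore] -/
theorem leadingIndex_unique (f : PowerSeries K) (d d' : ℕ)
    (hd : ∀ k, ‖coeff k f‖ ≤ ‖coeff d f‖) (hd' : ∀ k < d, ‖coeff k f‖ < ‖coeff d f‖)
    (he : ∀ k, ‖coeff k f‖ ≤ ‖coeff d' f‖) (he' : ∀ k < d', ‖coeff k f‖ < ‖coeff d' f‖) : d = d' := by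
  by_contra hne
  rcases Nat.lt_or_gt_of_ne hne with h | h
  · exact absurd (hd d') (not_le.2 (he' d h))
  · exact absurd (he d) (not_le.2 (hd' d' h))

/-- **Leading index of a finite product** (induction on `leadingIndex_mul`): if each `f i` (`i ∈ s`) has leading index `d i` with non-zero leading coefficient, then
`∏_{i∈s} f i` has leading index `∑_{i∈s} d i`, with non-zero leading coefficient. [cite: Washington1997, §7.1] -/
theorem leadingIndex_prod {ι : Type*} (s : Finset ι) (f : ι → PowerSeries K) (d : ι → ℕ)
    (hf : ∀ i ∈ s, (∀ k, ‖coeff k (f i)‖ ≤ ‖coeff (d i) (f i)‖) ∧ (∀ k < d i, ‖coeff k (f i)‖ < ‖coeff (d i) (f i)‖) ∧ coeff (d i) (f i) ≠ 0) :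
    (∀ k, ‖coeff k (∏ i ∈ s, f i)‖ ≤ ‖coeff (∑ i ∈ s, d i) (∏ i ∈ s, f i)‖) ∧
      (∀ k < ∑ i ∈ s, d i, ‖coeff k (∏ i ∈ s, f i)‖ < ‖coeff (∑ i ∈ s, d i) (∏ i ∈ s, f i)‖) ∧
      coeff (∑ i ∈ s, d i) (∏ i ∈ s, f i) ≠ 0 := by
  induction s using Finset.induction_on with
  | empty =>
    refine ⟨fun k ↦ ?_, fun k hk ↦ absurd hk (Nat.not_lt_zero _), by simp⟩
    rcases Nat.eq_zero_or_pos k with rfl | hk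
    · exact le_rfl
    · simp [coeff_one, hk.ne']
  | insert i s hi ih =>
    have hi' := hf i (Finset.mem_insert_self _ _)
    have ih' := ih fun j hj ↦ hf j (Finset.mem_insert_of_mem hj)
    rw [Finset.prod_insert hi, Finset.sum_insert hi]
    obtain ⟨htop, hle, hlt⟩ := leadingIndex_mul (f i) (∏ j ∈ s, f j) (d i) (∑ j ∈ s, d j) hi'.1 hi'.2.1 hi'.2.2 ih'.1 ih'.2.1 ih'.2.2
    refine ⟨hle, hlt, ?_⟩
    rw [← norm_pos_iff, htop]
    exact mul_pos (norm_pos_iff.2 hi'.2.2) (norm_pos_iff.2 ih'.2.2)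

end LeadingIndex

end Summit.BirchSwinnertonDyer.BirchSwinnertonDyer.Theorems.SmallImageCharSignedSelmer

end
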